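import Literature.AnabelianGeometry.EtaleTheta.ThetaFractionPairOfThetaTwistTower
import HarnessLib

/-!
# [EtTh] Prop. 4.3 (i) proof / §5 p.330 at the FOURTH tower model: the automorphisms `ρ_{A_⊙}(x)` with TRIVIAL TRANSLATION fix EVERY
# divisor class of `Φ(A_⊙)` — the junction binder `hθ′` (polar divisor `D₁` of `Θ̈`) holds EXACTLY on `{x | φ₃(φ x) = 1} ⊇ Π^tp_Ÿ`

S. Mochizuki, *The étale theta function …*, Publ. RIMS **45** (2009) [MochizukiEtTh2009], Prop. 1.4 (i)(ii) p.247–248 (PDF pp.21–22) (the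
divisor of poles `D₁` of `Θ̈`; the functional equation under the translation `Gal(Y/X) ≅ ℤ`), Rmk. 1.3.1 p.247, proof of Prop. 4.3 (i) p.317
(PDF p.91) («it suffices to observe that `Div(s′)`, `Div(s″)` are fixed by `H`»), §5 p.330 (PDF p.104), Def. 4.1 (ii) p.313 (PDF p.87) (the Galois
surjection `Π^tp_X ↠ Aut_D(A^bs)`); [SemiAnbd] = [MochizukiSemiAnbd2006] Rmk. 3.1.3 p.34 (`Aut(Π/N)` by right translations).
[cite: MochizukiEtTh2009, Prop 4.3 (i) p.317 (PDF p.91)]  PAGE CONVENTION for [EtTh]: «printed N (PDF p.M)», N = M + 226.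

PROOF-ONLY (theorems only; abc-iut cell, layer L2, seat abc-iut-L2-d2 gen 8; abc-iut-L2-lead R1224 / R1239 (4) rider D6b input of
plan/L2/SUBDAG-EtTh-JUNCTION.md: «hinvp — Π^tp_Ÿ-stability of the polar class only, NOT hθ′ ∀ Π^tp_X»).  Consumed BY NAME, nothing restated:
this seat's FILE A1/A2 (`YV`, `thetaPolesFam`, `ιΦ`, `thetaPolesΦ`, `thetaDen`, `thetaNum`; p505973/p507274), abc-iut-w5-d013's Galois
surjection at the temperoid `galoisSurjOf` with its pointwise law `galoisSurjOf_apply` (`a·x_A ↦ (a g⁻¹)·x_A`), abc-iut-L2-t3's quotient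
socket `mkOfQuotientTemperoid` (`…_galoisSurj_hom_hom`, `rfl`) and `Ÿ`-skeleton law `actDIV_thetaPoles_ne`, the weak realification
naturality `rlfMapWeak_toRealification_of`, FILE 4's `Φ₀_map_hom_eq` / `eN_self`.
* §1 `actDIV_eq_of_φ₃_eq_one` — an element of «GRP₃′» with trivial translation fixes every log-divisor of every level;
  **`phiZeroPull_galoisSurjOf_of_φ₃_eq_one`** — for `k` with `φ₃ k = 1` the Galois automorphism `ρ_A(k)` of ANY Galois covering `A` fixes
  EVERY `ψ ∈ Φ₀(A)` (its points move by `a·x_A ↦ (a k⁻¹)·x_A`, i.e. by conjugates of `k⁻¹`, all translation-free);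
  **`pull_ιΦ`** — FILE 4's `Φ` transition on classes along an endomorphism is pull-back (`eN = 1`); hence **`pull_galoisSurj_ιΦ_of_φ₃_eq_one`**:
  EVERY class `ι(ψ) ∈ Φ(A)` is fixed by `Φ(ρ_A(x))` whenever `φ₃(φ x) = 1`.
* §2 at the theta datum over the quotient socket: **`hθ'_thetaDen_of_φ₃_eq_one`** — `Φ(ρ_{A_⊙}(x))(Div s″) = Div s″` for every `x` with
  `φ₃(φ x) = 1` (the R1239 display clause «`φ₃ ∘ φ ∘ ιX = 1` on `Π^tp_Ÿ`» is exactly what makes it hold on `Π^tp_Ÿ`), the same for `Div s′`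
  (`hθ_thetaNum_of_φ₃_eq_one`, a second proof of a special case of FILE B1's `hθ_thetaNum`); and the HONEST converse
  **`pull_galoisSurj_div_thetaDen_ne`** — for `φ₃(φ x) ≠ 1` the polar class MOVES (Rmk. 1.3.1; `D₁` is not `Gal(Y/X)`-invariant), so
  abc-iut-L2-t4's `hinvp_of_thetaDivisor` hypothesis `hθ′ ∀ x : Π^tp_X` is FALSE at this datum for every `φ` with `φ₃ ∘ φ ≠ 1`: the
  polar input must be quantified over `Π^tp_Ÿ` (rider D6b, abc-iut-L2-t3).
HONEST FRAMING: class-(b) combinatorial DESIGN carrier (NOT the tempered Frobenioid of a Tate curve); onto-socket design-only (R1257); nothing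
here bears on [IUTchIII] Cor. 3.12; no side taken; typed ≠ proved.
-/

noncomputable section

namespace Literature.AnabelianGeometry.EtaleTheta

open CategoryTheory Opposite Function Literature.AlgebraicGeometry.Frobenioids Literature.AlgebraicGeometry.Frobenioids.QuasiTemperoid
  Literature.AnabelianGeometry.SemiGraphs Literature.AnabelianGeometry.SemiGraphs.GaloisObjects LogDivisorModel LogDivisorModel.GaloisAction
  LogDivisorTower

namespace ThetaTwistTowerTempered

open LogDivisorModel.TateTowerThetaTwist TateTowerKummerTwistRShear
open TateTowerKummerTwist (N eN eN_pos eN_self)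

/-! ## §1 Translation-free automorphisms fix every log-divisor family and every class -/

section Level

variable (m : ℕ)

/-- An element of «GRP₃′» with TRIVIAL TRANSLATION fixes every log-divisor of the level (the action on log-divisors is through `φ₃`).
[cite: MochizukiEtTh2009, Def 3.3 (iii) p.73] -/
theorem actDIV_eq_of_φ₃_eq_one {k : Compat 3 thetaShear} (hk : φ₃ k = 1) (d : (towerC₃sf.Z m).DIV) : (towerC₃sf.act m).actDIV k d = d := by
  change TateTowerTheta.baseAction.actDIV (Multiplicative.ofAdd (Multiplicative.toAdd (k : Grp 3 thetaShear).right.2)) d = d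
  rw [← φ₃_apply, hk, toAdd_one, ofAdd_zero, map_one, MulAut.one_apply]

variable {A : ConnectedPart (BTemp (Compat 3 thetaShear))} (hA : IsGaloisObj A.obj)

/-- **For `k` with `φ₃ k = 1` the Galois automorphism `ρ_A(k)` of a Galois covering `A` fixes EVERY `ψ ∈ Φ₀(A)`**: its points move by
`a·x_A ↦ (a k⁻¹)·x_A = (a k⁻¹ a⁻¹)·(a·x_A)`, and `φ₃(a k⁻¹ a⁻¹) = 0`. [cite: MochizukiEtTh2009, Prop 4.3 (i) p.317 (PDF p.91)] -/
theorem phiZeroPull_galoisSurjOf_of_φ₃_eq_one {k : Compat 3 thetaShear} (hk : φ₃ k = 1) (ψ : (towerC₃sf.act m).phiZero (gset A)) :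
    (towerC₃sf.act m).phiZeroPull (galoisSurjOf (isTemperedC 3 thetaShear) A.obj hA k).hom.hom ψ = ψ := by
  refine Subtype.ext (funext fun y => ?_)
  obtain ⟨a, rfl⟩ := exists_ρ_galoisBase_eq (isTemperedC 3 thetaShear) A.obj hA y
  change ψ.1 ((galoisSurjOf (isTemperedC 3 thetaShear) A.obj hA k).hom.hom.hom
      (A.obj.obj.ρ a (galoisBase (isTemperedC 3 thetaShear) A.obj hA))) =
    ψ.1 (A.obj.obj.ρ a (galoisBase (isTemperedC 3 thetaShear) A.obj hA))
  rw [galoisSurjOf_apply, ψ.2.2 (a * k⁻¹), ψ.2.2 a, map_mul, MulAut.mul_apply,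
    actDIV_eq_of_φ₃_eq_one m (k := k⁻¹) (by rw [map_inv, hk, inv_one])]

end Level

variable (R S : ((ConnectedPart (BTemp (Compat 3 thetaShear)))ᵒᵖ ⥤ CommMonCat.{0}) → Prop)

/-- **FILE 4's `Φ` transition on classes along an ENDOMORPHISM is plain pull-back** (`ι` natural for the weak realification; the ramification
power is `eN (lvl A) (lvl A) = 1`). [cite: MochizukiEtTh2009, Def 3.6 p.76] -/
theorem pull_ιΦ {A : ConnectedPart (BTemp (Compat 3 thetaShear))} (g : A ⟶ A) (ψ : dm.Φ₀.obj (op A)) :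
    pull (ThetaTwistTowerTempered.temperedFrobenioid R S).divisorMonoid g (ιΦ R S A ψ) =
      ιΦ R S A ((towerC₃sf.act (lvlC 3 thetaShear A)).phiZeroPull g.hom.hom ψ) := by
  apply Subtype.ext
  have h2 : (dm.Φ₀.map g.op).hom ψ = (towerC₃sf.act (lvlC 3 thetaShear A)).phiZeroPull g.hom.hom ψ := by
    rw [Φ₀_map_hom_eq]
    change (LogDivisorModel.TateTowerTheta.action φ₃).phiZeroPull g.hom.hom ψ ^ eN (lvlC 3 thetaShear A) (lvlC 3 thetaShear A) = _
    rw [eN_self, pow_one]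
    rfl
  have h1 := rlfMapWeak_toRealification_of dm.Φ₀ hpf g.op ψ
  rw [h2] at h1
  exact h1

/-- **Hence for `φ₃(φ x) = 1` EVERY class `ι(ψ) ∈ Φ(A)` is fixed by `Φ(ρ_A(x))`** at abc-iut-L2-t3's quotient-temperoid socket (any anchor).
[cite: MochizukiEtTh2009, Prop 4.3 (i) p.317 (PDF p.91)] -/
theorem pull_galoisSurj_ιΦ_of_φ₃_eq_one {K : Type 1} [Field K] (X : SemiGraphs.TemperedArithmeticGroup.{1} K)
    (φ : X.Pi →ₜ* Compat 3 thetaShear) (hφ : Function.Surjective φ)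
    (NH : Subgroup (Field.absoluteGaloisGroup K) → (ThetaTwistTowerTempered.temperedFrobenioid R S).category → ℕ+ → Prop)
    (A₀ : (ThetaTwistTowerTempered.temperedFrobenioid R S).category)
    (hA₀ : PreFrobenioid.IsFrobeniusTrivial (ThetaTwistTowerTempered.temperedFrobenioid R S).toElem A₀) (hA₀' : IsGaloisObj A₀.base.obj)
    {A : ConnectedPart (BTemp (Compat 3 thetaShear))} (hA : IsGaloisObj A.obj) {x : X.Pi} (hx : φ₃ (φ x) = 1) (ψ : dm.Φ₀.obj (op A)) :
    pull (ThetaTwistTowerTempered.temperedFrobenioid R S).divisorMonoid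
        ((BiKummerSetting.mkOfQuotientTemperoid X (isTemperedC 3 thetaShear) φ hφ (ThetaTwistTowerTempered.temperedFrobenioid R S)
          (monoidType_eq R S) (hP R S) NH A₀ hA₀ hA₀').galoisSurj A hA x).hom (ιΦ R S A ψ) = ιΦ R S A ψ := by
  rw [pull_ιΦ]
  exact congrArg (ιΦ R S A) (phiZeroPull_galoisSurjOf_of_φ₃_eq_one (lvlC 3 thetaShear A) hA hx ψ)

/-! ## §2 At the theta datum: `hθ′` on the translation-free part, and the polar class MOVES under every translation -/

variable (n : ℕ) {K : Type 1} [Field K] (X : SemiGraphs.TemperedArithmeticGroup.{1} K) (φ : X.Pi →ₜ* Compat 3 thetaShear)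
  (hφ : Function.Surjective φ)

/-- **`hθ′` ON THE TRANSLATION-FREE PART: `Φ(ρ_{A_⊙}(x))(Div s″) = Div s″` for every `x ∈ Π^tp_X` with `φ₃(φ x) = 1`** — the polar
divisor `D₁` of the theta function is fixed by every automorphism without translation component (so on `Π^tp_Ÿ` as soon as the junction's
display clause «`φ₃ ∘ φ ∘ ιX = 1` on `Π^tp_Ÿ`» holds). [cite: MochizukiEtTh2009, Prop 4.3 (i) p.317 (PDF p.91)] -/
theorem hθ'_thetaDen_of_φ₃_eq_one {x : X.Pi} (hx : φ₃ (φ x) = 1) :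
    pull (ThetaTwistTowerTempered.temperedFrobenioid R S).divisorMonoid
        ((BiKummerSetting.mkOfQuotientTemperoid X (isTemperedC 3 thetaShear) φ hφ (ThetaTwistTowerTempered.temperedFrobenioid R S)
          (monoidType_eq R S) (hP R S) (fun _ _ _ => True)
          ((ThetaTwistTowerTempered.temperedFrobenioid R S).quotConnZeroObj (isTemperedC 3 thetaShear) (vOpenNormal 3 thetaShear n))
          ((ThetaTwistTowerTempered.temperedFrobenioid R S).isFrobeniusTrivial_quotConnZeroObj (isTemperedC 3 thetaShear)
            (vOpenNormal 3 thetaShear n))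
          ((ThetaTwistTowerTempered.temperedFrobenioid R S).isGaloisObj_quotConnZeroObj_base (isTemperedC 3 thetaShear)
            (vOpenNormal 3 thetaShear n))).galoisSurj
          ((ThetaTwistTowerTempered.temperedFrobenioid R S).quotConnZeroObj (isTemperedC 3 thetaShear) (vOpenNormal 3 thetaShear n)).base
          ((ThetaTwistTowerTempered.temperedFrobenioid R S).isGaloisObj_quotConnZeroObj_base (isTemperedC 3 thetaShear)
            (vOpenNormal 3 thetaShear n)) x).hom
        (ModelFrobenioid.div (thetaDen R S n)) =
      ModelFrobenioid.div (thetaDen R S n) :=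
  pull_galoisSurj_ιΦ_of_φ₃_eq_one R S X φ hφ _ _ _ _ _ hx _

/-- The same for the zero divisor `Div s′` (a special case of FILE B1's unconditional `hθ_thetaNum`, recorded for symmetry).
[cite: MochizukiEtTh2009, §5 p.330 (PDF p.104)] -/
theorem hθ_thetaNum_of_φ₃_eq_one {x : X.Pi} (hx : φ₃ (φ x) = 1) :
    pull (ThetaTwistTowerTempered.temperedFrobenioid R S).divisorMonoid
        ((BiKummerSetting.mkOfQuotientTemperoid X (isTemperedC 3 thetaShear) φ hφ (ThetaTwistTowerTempered.temperedFrobenioid R S)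
          (monoidType_eq R S) (hP R S) (fun _ _ _ => True)
          ((ThetaTwistTowerTempered.temperedFrobenioid R S).quotConnZeroObj (isTemperedC 3 thetaShear) (vOpenNormal 3 thetaShear n))
          ((ThetaTwistTowerTempered.temperedFrobenioid R S).isFrobeniusTrivial_quotConnZeroObj (isTemperedC 3 thetaShear)
            (vOpenNormal 3 thetaShear n))
          ((ThetaTwistTowerTempered.temperedFrobenioid R S).isGaloisObj_quotConnZeroObj_base (isTemperedC 3 thetaShear)
            (vOpenNormal 3 thetaShear n))).galoisSurj
          ((ThetaTwistTowerTempered.temperedFrobenioid R S).quotConnZeroObj (isTemperedC 3 thetaShear) (vOpenNormal 3 thetaShear n)).base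
          ((ThetaTwistTowerTempered.temperedFrobenioid R S).isGaloisObj_quotConnZeroObj_base (isTemperedC 3 thetaShear)
            (vOpenNormal 3 thetaShear n)) x).hom
        (ModelFrobenioid.div (thetaNum R S n)) =
      ModelFrobenioid.div (thetaNum R S n) :=
  pull_galoisSurj_ιΦ_of_φ₃_eq_one R S X φ hφ _ _ _ _ _ hx _

/-- `ι` is injective on `Φ₀(A)` (`Φ₀^pf → Φ₀^rlf` injective, and `Φ₀ → Φ₀^pf` injective because positive powers are injective on the
`Ÿ`-skeleton's `Φ₀`). [cite: MochizukiEtTh2009, Def 3.6 p.76] -/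
theorem ιΦ_injective (A : ConnectedPart (BTemp (Compat 3 thetaShear))) : Injective (ιΦ R S A) := by
  intro a b h
  have h1 : Perfection.of _ a = Perfection.of _ b :=
    PfImageWeak.toRealification_injective (hpf (op A)).weak (congrArg Subtype.val h)
  rw [Perfection.of_apply, Perfection.of_apply] at h1
  obtain ⟨M, hM⟩ := Perfection.mk_eq_mk_iff.mp h1
  rw [PNat.one_coe, mul_one] at hM
  exact LogDivisorModel.TateTowerTheta.pow_left_injective φ₃ (gset A) M.pos hM

/-- **The polar family MOVES under every Galois automorphism WITH translation**: for `φ₃ k ≠ 1`, `ρ_{Y_n}(k)^* (D₁-family) ≠ D₁-family`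
(at the base point `x_{Y_n} = a₀·V_n` the value `a₀·D₁` is carried to `(a₀ k⁻¹)·D₁`, and `a₀ k⁻¹ a₀⁻¹` has translation `−φ₃ k ≠ 0`).
[cite: MochizukiEtTh2009, Rmk 1.3.1 p.247 (PDF p.21)] -/
theorem phiZeroPull_galoisSurjOf_thetaPolesFam_ne (m : ℕ) {k : Compat 3 thetaShear} (hk : φ₃ k ≠ 1) :
    (towerC₃sf.act m).phiZeroPull (galoisSurjOf (isTemperedC 3 thetaShear) (YV n).obj (isGaloisObj_Aodot_base R S n) k).hom.hom
        (thetaPolesFam n m) ≠ thetaPolesFam n m := by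
  intro h
  obtain ⟨a₀, ha₀⟩ := exists_ρ_yV_eq n (galoisBase (isTemperedC 3 thetaShear) (YV n).obj (isGaloisObj_Aodot_base R S n))
  have e := congrArg (fun ψ : (towerC₃sf.act m).phiZero (gset (YV n)) =>
    ψ.1 (galoisBase (isTemperedC 3 thetaShear) (YV n).obj (isGaloisObj_Aodot_base R S n))) h
  change (thetaPolesFam n m).1 ((galoisSurjOf (isTemperedC 3 thetaShear) (YV n).obj (isGaloisObj_Aodot_base R S n) k).hom.hom.hom
      (galoisBase (isTemperedC 3 thetaShear) (YV n).obj (isGaloisObj_Aodot_base R S n))) =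
    (thetaPolesFam n m).1 (galoisBase (isTemperedC 3 thetaShear) (YV n).obj (isGaloisObj_Aodot_base R S n)) at e
  rw [galoisSurjOf_apply_base, ← ha₀, (thetaPolesFam n m).2.2 k⁻¹, (thetaPolesFam n m).2.2 a₀, thetaPolesFam_apply_yV] at e
  -- `e : k⁻¹ · (a₀ · D₁) = a₀ · D₁`; apply `a₀⁻¹` and read the translation through `φ₃`
  have e2 : (towerC₃sf.act m).actDIV (a₀⁻¹ * k⁻¹ * a₀)
      ((TateTowerTheta.thetaPoles : TateTowerTheta.model.DIV) : (towerC₃sf.Z m).DIV) =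
      ((TateTowerTheta.thetaPoles : TateTowerTheta.model.DIV) : (towerC₃sf.Z m).DIV) := by
    rw [map_mul, map_mul, MulAut.mul_apply, MulAut.mul_apply, e, ← MulAut.mul_apply, ← map_mul, inv_mul_cancel, map_one,
      MulAut.one_apply]
  have hk' : φ₃ (a₀⁻¹ * k⁻¹ * a₀) ≠ 1 := by
    rw [map_mul, map_mul, map_inv, map_inv, mul_right_comm, inv_mul_cancel, one_mul]
    exact inv_ne_one.mpr hk
  exact LogDivisorModel.TateTowerTheta.actDIV_thetaPoles_ne φ₃ hk' e2

end ThetaTwistTowerTempered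

end Literature.AnabelianGeometry.EtaleTheta

end
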